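/-
Copyright: H21 K2-LIT squad (hodgecm-mathlib). Helper for crux hLiu418 = `stmt-HodgeConjecture-24832`
(route `route-HodgeConjecture-HCCMUnconditional`), G1 road (★ `K2LiuContinuationLieDerivative`) and its G2 inputs.
-/
import Literature.NumberTheory.Automorphic.UnitaryGroupArchSkew                      -- ★ `archSkew`, `expGL_smul_mem_arch`
import Literature.NumberTheory.Automorphic.UnitaryGroupAdelicProduct                 -- ★ `archPart_archToAdelic`, `finPart_archToAdelic`
import Literature.NumberTheory.Automorphic.AutomorphicFormsL2DerivativeIntegral      -- ★ `continuous_expGL_smul`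
import HarnessLib

/-!
# The archimedean one-parameter orbit `t ↦ ι_∞(exp tX)` in `U(J)(𝔸_F)` — definition

For `X` in the real Lie algebra `𝔲 = archSkew F E c N J` of `U(J)(E ⊗ ℝ)` (★ `UnitaryGroup.archSkew`; `exp tX ∈ U(J)(E ⊗ ℝ)` by
★ `expGL_smul_mem_arch`), the one-parameter subgroup `t ↦ (exp tX, 1) ∈ U(J)(𝔸_F)` typed in the **subgroup currency**
`UnitaryGroup.adelic F E c N J ≤ GL_N(𝔸_E)` — the currency of the #41 frame's `HA L e dV hdV dW hdW` (an `abbrev` for such an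
`adelic`), so that `h₀ * archExp … hX t : HA …` elaborates without transport (the datum-typed ★ `archToAdelic` lands in
`(adelicGroupData …).Adelic`, which is only definitionally the same type; `archExp_eq_archToAdelic` is the `rfl` bridge).

Contents: `archExp` (the definition) and its one-parameter-subgroup algebra — `coe_archExp`, `archExp_eq_archToAdelic`,
`archExp_zero`, `archExp_add`, `archExp_neg`, `archExp_comm`, `continuous_archExp`, `archPart_archExp`, `finPart_archExp`.

[cite: BorelJacquet1979, §4.1 (the archimedean component `G_∞ → G(𝔸)`)] [cite: Knapp2002, 0.§2 Prop. 0.11 (one-parameter subgroups `t ↦ exp tX`)]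
-/

set_option linter.dupNamespace false -- the mandated namespace repeats `HodgeConjecture.HodgeConjecture`

open Literature.NumberTheory.Automorphic Literature.NumberTheory.Automorphic.UnitaryGroup
-- `Classical` is needed to see the Mathlib normed-ring instances on `mixedSpace E` (note H5 of `AdelicGLnGlue`)
open scoped Classical
open NumberField NumberField.mixedEmbedding IsDedekindDomain

namespace Summit.HodgeConjecture.HodgeConjecture.Cruxes.HLiu418.K2LiuArchOneParameterOrbitDefs

variable (F E : Type) [Field F] [Field E] [NumberField E] [Algebra F E] (c : E ≃ₐ[F] E) (N : ℕ) (J : Matrix (Fin N) (Fin N) E)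

/-- **the archimedean one-parameter orbit** `archExp … hX t = (exp tX, 1) ∈ U(J)(𝔸_F)` of `X ∈ 𝔲 = archSkew F E c N J`, typed in the
subgroup `UnitaryGroup.adelic F E c N J ≤ GL_N(𝔸_E)`. [cite: BorelJacquet1979, §4.1] [cite: Knapp2002, 0.§2 Prop. 0.11] -/
noncomputable def archExp {X : Matrix (Fin N) (Fin N) (mixedSpace E)} (hX : X ∈ archSkew F E c N J) (t : ℝ) : adelic F E c N J :=
  ⟨GLn.ofInfinite N E (expGL (t • X)), (ofInfinite_mem_adelic_iff F E c N J _).2 (expGL_smul_mem_arch J hX t)⟩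

variable {X : Matrix (Fin N) (Fin N) (mixedSpace E)} (hX : X ∈ archSkew F E c N J)

/-- `archExp hX t = (exp tX, 1)` in `GL_N(𝔸_E)`. [cite: BorelJacquet1979, §4.1] -/
@[simp] theorem coe_archExp (t : ℝ) :
    ((archExp F E c N J hX t : adelic F E c N J) : GL (Fin N) (AdeleRing (𝓞 E) E)) = GLn.ofInfinite N E (expGL (t • X)) := rfl

/-- `archExp hX 0 = 1`. [cite: Knapp2002, 0.§2 Prop. 0.11] -/
@[simp] theorem archExp_zero : archExp F E c N J hX 0 = 1 := by
  ext : 1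
  rw [coe_archExp, zero_smul, expGL_zero, map_one, Subgroup.coe_one]

/-- **one-parameter subgroup law** `archExp hX (s + t) = archExp hX s * archExp hX t`. [cite: Knapp2002, 0.§2 Prop. 0.11(c)] -/
theorem archExp_add (s t : ℝ) : archExp F E c N J hX (s + t) = archExp F E c N J hX s * archExp F E c N J hX t := by
  ext : 1
  rw [Subgroup.coe_mul, coe_archExp, coe_archExp, coe_archExp, expGL_add_smul, map_mul]

/-- `archExp hX (-t) = (archExp hX t)⁻¹`. [cite: Knapp2002, 0.§2 Prop. 0.11] -/
theorem archExp_neg (t : ℝ) : archExp F E c N J hX (-t) = (archExp F E c N J hX t)⁻¹ := by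
  ext : 1
  rw [Subgroup.coe_inv, coe_archExp, coe_archExp, neg_smul, expGL_neg, map_inv]

/-- the values of a one-parameter subgroup commute: `archExp hX s * archExp hX t = archExp hX t * archExp hX s`. [cite: Knapp2002, 0.§2 Prop. 0.11] -/
theorem archExp_comm (s t : ℝ) : archExp F E c N J hX s * archExp F E c N J hX t = archExp F E c N J hX t * archExp F E c N J hX s := by
  rw [← archExp_add, ← archExp_add, add_comm]

/-- `archExp hX (t + s) = archExp hX s * archExp hX t` (the form used to move a derivative at `t` to a derivative at `0` by a
right translation). [cite: Knapp2002, 0.§2 Prop. 0.11(c)] -/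
theorem archExp_add_comm (s t : ℝ) : archExp F E c N J hX (t + s) = archExp F E c N J hX s * archExp F E c N J hX t := by
  rw [archExp_add, archExp_comm]

/-- **`t ↦ archExp hX t` is continuous** (★ `continuous_expGL_smul`, `GLn.continuous_ofInfinite`). [cite: BorelJacquet1979, §4.1] -/
theorem continuous_archExp : Continuous (archExp F E c N J hX) :=
  Continuous.subtype_mk ((GLn.continuous_ofInfinite N E).comp (continuous_expGL_smul X)) _

/-- **left translates of the orbit are continuous**: `t ↦ h₀ * archExp hX t`. [cite: BorelJacquet1979, §4.1] -/
theorem continuous_mul_archExp (h₀ : adelic F E c N J) : Continuous fun t : ℝ => h₀ * archExp F E c N J hX t :=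
  continuous_const.mul (continuous_archExp F E c N J hX)

variable [NumberField F]

/-- **bridge to the datum-typed embedding**: `archExp hX t = archToAdelic ⟨exp tX, _⟩` (definitional). [cite: BorelJacquet1979, §4.1] -/
theorem archExp_eq_archToAdelic (t : ℝ) :
    archExp F E c N J hX t = archToAdelic F E c N J ⟨expGL (t • X), expGL_smul_mem_arch J hX t⟩ := rfl

/-- `(archExp hX t)_∞ = exp tX`. [cite: BorelJacquet1979, §4.1] -/
@[simp] theorem archPart_archExp (t : ℝ) :
    archPart F E c N J (archExp F E c N J hX t) = ⟨expGL (t • X), expGL_smul_mem_arch J hX t⟩ := by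
  rw [archExp_eq_archToAdelic, archPart_archToAdelic]

/-- `(archExp hX t)_f = 1`. [cite: BorelJacquet1979, §4.1] -/
@[simp] theorem finPart_archExp (t : ℝ) : finPart F E c N J (archExp F E c N J hX t) = 1 := by
  rw [archExp_eq_archToAdelic, finPart_archToAdelic]

end Summit.HodgeConjecture.HodgeConjecture.Cruxes.HLiu418.K2LiuArchOneParameterOrbitDefs

/-! ## 2. The archimedean and finite embeddings in SUBGROUP currency (appended 2026-09-04, G2-PS-B «(D-ht)»)

★ `UnitaryGroup.archToAdelic` ∕ `finAdelicToAdelic` land in the datum type `(adelicGroupData F E c N J).Adelic`, which is definitionally but not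
reducibly the subgroup type `↥(adelic F E c N J)` of the #41 frame (`HA … := adelic …`): a product `h * archToAdelic … a` with `h : HA …` does not
elaborate (no `HMul ↥HA (adelicGroupData …).Adelic`). The two maps below are the SAME homomorphisms typed into the subgroup (`rfl` bridges
`archEmb_eq_archToAdelic`, `finEmb_eq_finAdelicToAdelic`), with the product ∕ commutation ∕ component API transported, so that Iwasawa-type
factorisations `k = (k_∞, 1) · (1, k_f)` can be written inside `HA`. [cite: BorelJacquet1979, §4.1 (`G(𝔸) = G_∞ × G(𝔸_f)`)] -/

namespace Summit.HodgeConjecture.HodgeConjecture.Cruxes.HLiu418.K2LiuArchOneParameterOrbitDefs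

variable (F E : Type) [Field F] [NumberField F] [Field E] [NumberField E] [Algebra F E] (c : E ≃ₐ[F] E) (N : ℕ)
  (J : Matrix (Fin N) (Fin N) E)

/-- **`U(J)(E ⊗ ℝ) →* U(J)(𝔸_F)`, `a ↦ (a, 1)`, typed into the SUBGROUP `adelic F E c N J ≤ GL_N(𝔸_E)`** (= ★ `archToAdelic` definitionally).
[cite: BorelJacquet1979, §4.1] -/
noncomputable def archEmb : arch F E c N J →* adelic F E c N J :=
  ((GLn.ofInfinite N E).comp (arch F E c N J).subtype).codRestrict (adelic F E c N J)
    fun g => (ofInfinite_mem_adelic_iff F E c N J g.1).2 g.2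

/-- **`U(J)(𝔸_{F,f}) →* U(J)(𝔸_F)`, `b ↦ (1, b)`, typed into the SUBGROUP `adelic F E c N J`** (= ★ `finAdelicToAdelic` definitionally).
[cite: BorelJacquet1979, §4.1] -/
noncomputable def finEmb : finAdelic F E c N J →* adelic F E c N J :=
  ((GLn.ofFinite N E).comp (finAdelic F E c N J).subtype).codRestrict (adelic F E c N J)
    fun g => (ofFinite_mem_adelic_iff F E c N J g.1).2 g.2

/-- `archEmb a = archToAdelic a` (definitional bridge to the datum-typed map). [cite: BorelJacquet1979, §4.1] -/
theorem archEmb_eq_archToAdelic (a : arch F E c N J) : archEmb F E c N J a = archToAdelic F E c N J a := rfl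

/-- `finEmb b = finAdelicToAdelic b` (definitional bridge to the datum-typed map). [cite: BorelJacquet1979, §4.1] -/
theorem finEmb_eq_finAdelicToAdelic (b : finAdelic F E c N J) : finEmb F E c N J b = finAdelicToAdelic F E c N J b := rfl

omit [NumberField F] in
/-- `archEmb a = (a, 1)` in `GL_N(𝔸_E)`. [cite: BorelJacquet1979, §4.1] -/
@[simp] theorem coe_archEmb (a : arch F E c N J) :
    ((archEmb F E c N J a : adelic F E c N J) : GL (Fin N) (AdeleRing (𝓞 E) E)) = GLn.ofInfinite N E a := rfl

omit [NumberField F] in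
/-- `finEmb b = (1, b)` in `GL_N(𝔸_E)`. [cite: BorelJacquet1979, §4.1] -/
@[simp] theorem coe_finEmb (b : finAdelic F E c N J) :
    ((finEmb F E c N J b : adelic F E c N J) : GL (Fin N) (AdeleRing (𝓞 E) E)) = GLn.ofFinite N E b := rfl

omit [NumberField F] in
/-- `archExp hX t = archEmb (exp tX)`. [cite: BorelJacquet1979, §4.1] -/
theorem archExp_eq_archEmb {X : Matrix (Fin N) (Fin N) (mixedSpace E)} (hX : X ∈ archSkew F E c N J) (t : ℝ) :
    archExp F E c N J hX t = archEmb F E c N J ⟨expGL (t • X), expGL_smul_mem_arch J hX t⟩ := rfl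

/-- `(archEmb a)_∞ = a`. [cite: BorelJacquet1979, §4.1] -/
@[simp] theorem archPart_archEmb (a : arch F E c N J) : archPart F E c N J (archEmb F E c N J a) = a :=
  archPart_archToAdelic F E c N J a

/-- `(archEmb a)_f = 1`. [cite: BorelJacquet1979, §4.1] -/
@[simp] theorem finPart_archEmb (a : arch F E c N J) : finPart F E c N J (archEmb F E c N J a) = 1 :=
  finPart_archToAdelic F E c N J a

/-- `(finEmb b)_∞ = 1`. [cite: BorelJacquet1979, §4.1] -/
@[simp] theorem archPart_finEmb (b : finAdelic F E c N J) : archPart F E c N J (finEmb F E c N J b) = 1 :=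
  archPart_finAdelicToAdelic F E c N J b

/-- `(finEmb b)_f = b`. [cite: BorelJacquet1979, §4.1] -/
@[simp] theorem finPart_finEmb (b : finAdelic F E c N J) : finPart F E c N J (finEmb F E c N J b) = b :=
  finPart_finAdelicToAdelic F E c N J b

/-- **`k = (k_∞, 1) · (1, k_f)` inside the subgroup**: `archEmb (archPart k) * finEmb (finPart k) = k`. [cite: BorelJacquet1979, §4.1] -/
theorem archEmb_mul_finEmb (k : adelic F E c N J) :
    archEmb F E c N J (archPart F E c N J k) * finEmb F E c N J (finPart F E c N J k) = k :=
  archToAdelic_mul_finAdelicToAdelic F E c N J k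

/-- the archimedean and finite embeddings commute: `(a, 1) · (1, b) = (1, b) · (a, 1)`. [cite: BorelJacquet1979, §4.1] -/
theorem archEmb_mul_finEmb_comm (a : arch F E c N J) (b : finAdelic F E c N J) :
    archEmb F E c N J a * finEmb F E c N J b = finEmb F E c N J b * archEmb F E c N J a :=
  (commute_archToAdelic_finAdelicToAdelic F E c N J a b).eq

omit [NumberField F] in
/-- `archEmb` is continuous. [cite: BorelJacquet1979, §4.1] -/
theorem continuous_archEmb : Continuous (archEmb F E c N J) :=
  Continuous.subtype_mk ((GLn.continuous_ofInfinite N E).comp continuous_subtype_val) _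

end Summit.HodgeConjecture.HodgeConjecture.Cruxes.HLiu418.K2LiuArchOneParameterOrbitDefs
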